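import Literature.MathematicalPhysics.QuantumFieldTheory.Balaban1983to89.Node00.ROperationOfRecord1100
import Literature.MathematicalPhysics.QuantumFieldTheory.Balaban1983to89.B16Cor3Ops

/-!
# NODE 00 — DEFINER ₇ (R-side), v3: `R` of record as the COMPLETE renormalization operation 𝐑 of [B16] (1.72) on the
# (1.72)-represented tower of record, the identity elsewhere; (0.4) ∕ «equivalent, but not equal» and integrability as THEOREMS

Seat `pub-ymgap-node00-def-R` (DEFINER ₇).  [B16] = [Balaban1989LargeFieldII], [IV] = [Balaban1989LargeFieldI].  Third and last instance
of the uniform totalisation mechanism `totalOp` of v2 (`Node00/ROperationOfRecord1100.lean` §1a, which announced it: «v3 = [B16] (1.72) will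
be its next instance»); v1 = [IV] (0.3) on the (2.18)-represented tower (`ROp03…OfRecord`, the one the NODE 00 records bind), v2 = [IV] (1.100) 𝐑′.

WHAT THIS FILE IS.  The tree types (1.72) p. 379 — *"𝐑ρ_k = Σ_{Z_k} Σ_{{Y_1,…,Y_m}} χ_k(…) (Σ 𝐓″_k(Z_k)) exp A′_k Π_i 𝐓_k(Y_i) {Σ_n Σ_{{X_j}} Π_j
𝐓′_k(X_j) exp Σ_Y V(Y, U_k)}"* — as an OBJECT: `B16Cor3Ops.Repr172 Cfg Dom` (index set `Adm` of the double sum, the characteristic functions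
`χ a`, the positive operations `TZ a` ∕ `TYs a`, the completed action `A'`, the curly bracket `curly a`, the all-small summand) with the summand
`Repr172.term` and the predicate `Repr172.Holds R Rρ : ∀ V, Rρ V = Σ_a term_a V`.  v3 of `R` of record is the OPERATOR FORM of that display:
the (1.72) datum READ AT a density (`rep : Density → Repr172`, the stage residual — the 𝐓-operation data of [III] p. 254 ∕ the 𝐓′, 𝐓″ of
[IV] p. 200 are DATA of the datum, never axioms) and ASSEMBLED by the printed formula (`density172 R := V ↦ Σ_a term_a V`, so that `Holds` is
`rfl`), TOTALISED as in v1∕v2 (chair R434 (c1)): at a density `ρ` whose assembled (1.72) density has the same integral as `ρ` (print p. 378: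
the new density is *«equivalent, but not equal»* to the old — equal integrals, the sense of (1.99) [IV] ∕ (0.4)) and is integrable, `R ρ := Σ_a
term_a`; elsewhere `R ρ := ρ`.  CONSEQUENCE: `Residual₅.preservesIntegral_R` ∕ `integrable_R` shapes are THEOREMS for every density BY
CONSTRUCTION, and on the printed branch (1.72) HOLDS for `R ρ` on the datum read at `ρ` (`holds_R172OfRecord_of_admissible`).  And the
bookkeeping face of p. 390 *«From (1.72), (1.98), and the above definitions, it follows that the result 𝐑ρ_k of the R-operation can be written
in the form (2.18) [III]»*: two assembled-density readers that agree at `ρ` give the same total operator at `ρ` (`totalOp_congr_at`,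
`r172Total_eq_totalOp_of_eq`, `R172OfRecord_eq_totalOp_of_eq`) — so v3 agrees with v1 ∕ v2 ∕ a (2.18)-format reader wherever their data
assemble to the same density; THAT they do is (1.73)–(1.98), not asserted.

HONEST LIMIT, said plainly (as in v2): the theorems here carry no analytic content.  The content of [B16] Thm 1 ∕ (1.72)–(1.79) — that the
densities OF THE INDUCTION admit the representation (1.72) with the bounds (1.79), analyticity p. 383, (1.80), (1.89) — is the statement that
the tower's densities are admissible with the datum of record, i.e. `B16Sect1DisplaysPrinted`'s claim shape at the objects of record: an
N12∕N13-side theorem, NOT asserted here.  No record binds v3 tonight (₅…₉ bind v1's `ROp03SuppOfRecord` ∕ the induced `shadowR`); it is filed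
so that the PURPOSE's reading list ([B16] §1 (1.1)–(1.104)) has its operator of record, for the term-tower successor records (def-T's
`TermTowerOfRecord`, DEDUP №11) to bind or ignore.

Nothing of Bałaban's is asserted.  No `instance`, no `notation`, no `sorry` ∕ `axiom` ∕ `opaque`.  HONEST FRAMING: definitions of record +
kernel bookkeeping; counts unmoved; NOT continuum ∕ ℝ⁴ ∕ OS ∕ mass-gap ∕ Clay.
-/

noncomputable section

open MeasureTheory
open scoped BigOperators

namespace Literature.MathematicalPhysics.QuantumFieldTheory.Balaban1983to89.Node00

open T4Continuum B16Cor3Ops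

section Generic

variable {P : Params} {j : ℕ} {G : Type*} {Dom : Type*}

/-! ### §1 The (1.72) instance of the uniform totalisation mechanism -/

/-- **The assembled (1.72) density of a datum**: `V ↦ Σ_a term_a(V)` — the right-hand side of (1.72) as a function of `V_k`.
[cite: Balaban1989LargeFieldII, (1.72) p.379] -/
def density172 (R : Repr172 (GaugeField P j G) Dom) : Density P j G :=
  fun V => ∑ a, R.term a V

/-- (1.72) HOLDS for the assembled density of a datum, by `rfl`. [cite: Balaban1989LargeFieldII, (1.72) p.379 (bookkeeping)] -/
theorem holds_density172 (R : Repr172 (GaugeField P j G) Dom) : R.Holds (density172 R) :=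
  fun _ => rfl

/-- A density for which (1.72) holds on the datum IS the assembled density. [cite: Balaban1989LargeFieldII, (1.72) p.379 (bookkeeping)] -/
theorem eq_density172_of_holds (R : Repr172 (GaugeField P j G) Dom) {Rρ : Density P j G} (h : R.Holds Rρ) :
    Rρ = density172 R :=
  funext h

/-- (1.72) holds for `Rρ` on the datum iff `Rρ` is the assembled density. [cite: Balaban1989LargeFieldII, (1.72) p.379 (bookkeeping)] -/
theorem holds_iff_eq_density172 (R : Repr172 (GaugeField P j G) Dom) (Rρ : Density P j G) :
    R.Holds Rρ ↔ Rρ = density172 R :=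
  ⟨eq_density172_of_holds R, fun h => h ▸ holds_density172 R⟩

variable [GaugeGroup G] [MeasurableSpace G] [HaarData G]

/-- **Admissibility of `ρ` for the (1.72) datum read at it**: the assembled density has the same integral as `ρ` (p. 378 «equivalent, but
not equal»; (0.4) [IV]) and is integrable — `AdmissibleOut` of v2 at the (1.72) reader. [cite: Balaban1989LargeFieldII, p.378, (1.72) p.379] -/
def Admissible172 (R : Repr172 (GaugeField P j G) Dom) (ρ : Density P j G) : Prop :=
  AdmissibleOut (density172 R) ρ

/-- Unfolding of `Admissible172`. [cite: Balaban1989LargeFieldII, (1.72) p.379 (bookkeeping)] -/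
theorem admissible172_iff (R : Repr172 (GaugeField P j G) Dom) (ρ : Density P j G) :
    Admissible172 R ρ ↔
      ∫ V, density172 R V ∂(fieldMeasure P j G) = ∫ V, ρ V ∂(fieldMeasure P j G) ∧ Integrable (density172 R) (fieldMeasure P j G) :=
  Iff.rfl

/-- **The total (1.72) operator of a reader** `rep : Density → Repr172`: `Σ_a term_a` of the datum read at `ρ` on admissible `ρ`, the identity
elsewhere (chair R434 (c1)). [cite: Balaban1989LargeFieldII, (1.72) p.379; Balaban1989LargeFieldI, (0.3) p.176 (typing convention)] -/
def r172Total (rep : Density P j G → Repr172 (GaugeField P j G) Dom) : Density P j G → Density P j G :=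
  totalOp fun ρ => density172 (rep ρ)

/-- The printed branch. [cite: Balaban1989LargeFieldII, (1.72) p.379 (bookkeeping)] -/
theorem r172Total_of_admissible {rep : Density P j G → Repr172 (GaugeField P j G) Dom} {ρ : Density P j G}
    (h : Admissible172 (rep ρ) ρ) : r172Total rep ρ = density172 (rep ρ) :=
  totalOp_of_admissible h

/-- The conventional branch. [cite: Balaban1989LargeFieldI, (0.3) p.176 (typing convention)] -/
theorem r172Total_of_not {rep : Density P j G → Repr172 (GaugeField P j G) Dom} {ρ : Density P j G}
    (h : ¬ Admissible172 (rep ρ) ρ) : r172Total rep ρ = ρ :=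
  totalOp_of_not h

/-- **(0.4) ∕ «equivalent, but not equal» for the total (1.72) operator, every density** — by construction.
[cite: Balaban1989LargeFieldII, p.378; Balaban1989LargeFieldI, (0.4) p.176] -/
theorem preservesIntegral_r172Total (rep : Density P j G → Repr172 (GaugeField P j G) Dom) : PreservesIntegral (r172Total rep) :=
  preservesIntegral_totalOp _

/-- The total (1.72) operator preserves integrability, every density — by construction. [cite: Balaban1989LargeFieldII, (1.72) p.379 (bookkeeping)] -/
theorem integrable_r172Total (rep : Density P j G → Repr172 (GaugeField P j G) Dom) {ρ : Density P j G}
    (hρ : Integrable ρ (fieldMeasure P j G)) : Integrable (r172Total rep ρ) (fieldMeasure P j G) :=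
  integrable_totalOp _ hρ

/-- **On the printed branch (1.72) HOLDS** for `r172Total rep ρ` on the datum read at `ρ`. [cite: Balaban1989LargeFieldII, (1.72) p.379] -/
theorem holds_r172Total_of_admissible {rep : Density P j G → Repr172 (GaugeField P j G) Dom} {ρ : Density P j G}
    (h : Admissible172 (rep ρ) ρ) : (rep ρ).Holds (r172Total rep ρ) := by
  rw [r172Total_of_admissible h]
  exact holds_density172 (rep ρ)

/-- On an admissible TOWER (every density in `S` admissible for the datum read at it) the total operator IS the printed 𝐑 along `S`.
[cite: Balaban1989LargeFieldII, (1.72) p.379 (bookkeeping)] -/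
theorem r172Total_eq_on {rep : Density P j G → Repr172 (GaugeField P j G) Dom} {S : Set (Density P j G)}
    (hS : ∀ ρ ∈ S, Admissible172 (rep ρ) ρ) {ρ : Density P j G} (hρ : ρ ∈ S) : r172Total rep ρ = density172 (rep ρ) :=
  r172Total_of_admissible (hS ρ hρ)


/-- **`totalOp` congruence at a density**: two assembled-density readers that agree AT `ρ` give the same total operator AT `ρ`
(both branches and the admissibility test read only `out ρ`). [cite: Balaban1989LargeFieldI, (0.3) p.176 (typing convention)] -/
theorem totalOp_congr_at {out out' : Density P j G → Density P j G} {ρ : Density P j G} (h : out ρ = out' ρ) :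
    totalOp out ρ = totalOp out' ρ := by
  by_cases hA : AdmissibleOut (out ρ) ρ
  · have hA' : AdmissibleOut (out' ρ) ρ := h ▸ hA
    rw [totalOp_of_admissible hA, totalOp_of_admissible hA', h]
  · have hA' : ¬ AdmissibleOut (out' ρ) ρ := h ▸ hA
    rw [totalOp_of_not hA, totalOp_of_not hA']

/-- **«can be written in the form (2.18) [III]», p. 390** — the bookkeeping face of [B16] p. 390 *«From (1.72), (1.98), and the above
definitions, it follows that the result 𝐑ρ_k of the R-operation can be written in the form (2.18) [III]»*: whenever the (1.72) datum READ AT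
`ρ` assembles to the same density as another assembled-density reader `out` at `ρ` (v1's (0.3) reader, v2's (1.100) reader
`fun ρ => rPrime1100 (rep' ρ)`, a (2.18)-format reader), the total (1.72) operator agrees with `totalOp out` at `ρ`.  Nothing says the
data of record DO so assemble — that is the content of (1.73)–(1.98). [cite: Balaban1989LargeFieldII, p.390; Balaban1988Convergent, (2.18) p.257] -/
theorem r172Total_eq_totalOp_of_eq {rep : Density P j G → Repr172 (GaugeField P j G) Dom} {out : Density P j G → Density P j G}
    {ρ : Density P j G} (h : density172 (rep ρ) = out ρ) : r172Total rep ρ = totalOp out ρ :=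
  totalOp_congr_at h

end Generic

/-! ### §2 At the objects of record -/

variable (F : T4Family) (N : ℕ) [NeZero N]

/-- **The (1.72)-representation extraction** (stage residual, v3): for each run `p` and step `k`, the datum of 𝐑 (1.72) — index set of the
double sum `Σ_{Z_k} Σ_{{Y_i}}`, `χ_k(…)`, the operations `Σ𝐓″_k(Z_k)` and `Π_i 𝐓_k(Y_i)` (the 𝐓-operation DATA of [III] p. 254 ∕ [IV] p. 200,
carried as data, never as axioms), `exp A′_k`, the curly bracket — READ AT a density of `T^{(k+1)}`; localization domains = subsets of the
`L^{−k}`-lattice sites of the run's torus. [cite: Balaban1989LargeFieldII, (1.71)–(1.72) pp.378–379] -/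
abbrev Rep172OfRecord : Type 1 :=
  (p : B12.RunParams) → (k : ℕ) → Density (F.P p.K) (k + 1) (SU N) →
    Repr172 (GaugeField (F.P p.K) (k + 1) (SU N)) (Set (Site (F.P p.K) 0))

/-- **`R` OF RECORD (v3)** — [B16] (1.72) p. 379, the complete renormalization operation 𝐑 on the (1.72)-represented tower of record, the
identity elsewhere; `Residual₅.R`'s exact shape. [cite: Balaban1989LargeFieldII, (1.72) p.379] -/
def R172OfRecord (rep : Rep172OfRecord F N) (p : B12.RunParams) (k : ℕ) :
    Density (F.P p.K) (k + 1) (SU N) → Density (F.P p.K) (k + 1) (SU N) :=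
  r172Total (rep p k)

/-- **(0.4) ∕ «equivalent, but not equal» for `R` of record (v3), every density** — `Residual₅.preservesIntegral_R`'s exact shape.
[cite: Balaban1989LargeFieldII, p.378; Balaban1989LargeFieldI, (0.4) p.176] -/
theorem preservesIntegral_R172OfRecord (rep : Rep172OfRecord F N) :
    ∀ (p : B12.RunParams) (k : ℕ), k < p.K → PreservesIntegral (R172OfRecord F N rep p k) :=
  fun p k _ => preservesIntegral_r172Total (rep p k)

/-- `R` of record (v3) preserves integrability, every density — `Residual₅.integrable_R`'s exact shape.
[cite: Balaban1989LargeFieldII, (1.72) p.379 (bookkeeping)] -/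
theorem integrable_R172OfRecord (rep : Rep172OfRecord F N) :
    ∀ (p : B12.RunParams) (k : ℕ), k < p.K → ∀ ρ : Density (F.P p.K) (k + 1) (SU N),
      Integrable ρ (fieldMeasure (F.P p.K) (k + 1) (SU N)) →
        Integrable (R172OfRecord F N rep p k ρ) (fieldMeasure (F.P p.K) (k + 1) (SU N)) :=
  fun p k _ _ hρ => integrable_r172Total (rep p k) hρ

/-- On the printed branch (1.72) HOLDS for `R` of record (v3) at `ρ` on the datum read at `ρ`. [cite: Balaban1989LargeFieldII, (1.72) p.379] -/
theorem holds_R172OfRecord_of_admissible (rep : Rep172OfRecord F N) (p : B12.RunParams) (k : ℕ)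
    {ρ : Density (F.P p.K) (k + 1) (SU N)} (h : Admissible172 (rep p k ρ) ρ) :
    (rep p k ρ).Holds (R172OfRecord F N rep p k ρ) :=
  holds_r172Total_of_admissible h

/-- Off the printed branch `R` of record (v3) is the identity. [cite: Balaban1989LargeFieldI, (0.3) p.176 (typing convention)] -/
theorem R172OfRecord_of_not (rep : Rep172OfRecord F N) (p : B12.RunParams) (k : ℕ)
    {ρ : Density (F.P p.K) (k + 1) (SU N)} (h : ¬ Admissible172 (rep p k ρ) ρ) : R172OfRecord F N rep p k ρ = ρ :=
  r172Total_of_not h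


/-- **p. 390 at the objects of record**: if the (1.72) datum of record read at `ρ` assembles to the same density as a reader `out` at `ρ`,
`R` of record (v3) agrees with `totalOp out` at `ρ` — e.g. a (2.18)-format reader of a ₉⁺ record, or v2's (1.100) reader: in v2's cone
`ROfRecord F N rep' p k = rPrimeTotal (rep' p k) = totalOp fun ρ => rPrime1100 (rep' p k ρ)` (both `rfl`), so `out := fun ρ => rPrime1100 (rep' p k ρ)`
gives `R172OfRecord F N rep p k ρ = ROfRecord F N rep' p k ρ` by `show …; exact` THERE (not stated here: v2's faces are `open Classical`-closed in
`DecidableEq (PBond …)` and this file keeps its faces instance-free — TS-8 hygiene, as in FILE 9′).  Bookkeeping; the assembling identity is NOT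
asserted. [cite: Balaban1989LargeFieldII, p.390] -/
theorem R172OfRecord_eq_totalOp_of_eq (rep : Rep172OfRecord F N) (p : B12.RunParams) (k : ℕ)
    {out : Density (F.P p.K) (k + 1) (SU N) → Density (F.P p.K) (k + 1) (SU N)} {ρ : Density (F.P p.K) (k + 1) (SU N)}
    (h : density172 (rep p k ρ) = out ρ) : R172OfRecord F N rep p k ρ = totalOp out ρ :=
  r172Total_eq_totalOp_of_eq h

end Literature.MathematicalPhysics.QuantumFieldTheory.Balaban1983to89.Node00

end
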